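import Mathlib.Algebra.Lie.Free
import Mathlib.Algebra.Lie.Quotient
import Mathlib.Algebra.Lie.Derivation.Basic
import Mathlib.Algebra.Lie.Graded
import Mathlib.Algebra.Lie.Submodule
import Mathlib.Algebra.Lie.Subalgebra
import Mathlib.Algebra.Lie.OfAssociative
import Mathlib.Algebra.Free
import Mathlib.GroupTheory.Nilpotent
import Literature.Topology.FourManifolds.GroupTrisections
import HarnessLib

/-!
# The surface Lie algebra `𝔰_g`, its bracket-length grading, and `Der⁺(𝔰_g)`

Topic `Literature/Algebra/Lie`; definition request `defn-SurfaceLieAlgebraDer` (route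
`SmoothPoincare4/CongruenceShadows`, item `LieGateIdentity`, card
artin-approximation-trisection-groups K1/D1). Pure Lie algebra over Mathlib (`FreeLieAlgebra`,
`LieIdeal`, Lie quotients, `LieDerivation`, `SetLike.GradedBracket`).

## Content

* **Bracket-length pieces of any Lie algebra** `L` relative to a family `f : X → L`
  (`bracketWord`, `wordGrade R f n` = span of the `n`-fold iterated brackets of the `f x`):
  `⁅L_m, L_n⁆ ⊆ L_{m+n}` (`lie_mem_wordGrade`, a `SetLike.GradedBracket` instance), `L_0 = ⊥`,
  `L_1 = span (range f)`, functoriality (`map_wordGrade`), and `∑ₙ L_n = L` when `f` generates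
  (`iSup_wordGrade_eq_top`). For the free Lie algebra and `f = FreeLieAlgebra.of R` this is the
  standard `ℕ`-grading; for a quotient by a bracket-homogeneous relation the induced one.
* **Homogeneous derivations** `derOfDegree ℒ k = {D | D(ℒ_i) ⊆ ℒ_{i+k}}` (again
  `GradedBracket`), the positive part `derPos ℒ = ∑_{k≥1} Der_k` as a Lie subalgebra of
  `Der(L) = LieDerivation R L L`, and the **stabiliser** `derStabilizer N = {D | D(N) ⊆ N}` of a
  submodule/ideal, with the finite criterion `mem_derStabilizer_lieSpan`.
* **The surface Lie algebra** `SurfaceLieAlgebra R g = 𝔰_g(R) = FreeLie_R(Fin g × Bool) ⧸ (ω)`,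
  `ω = surfaceOmega = ∑ᵢ ⁅aᵢ, bᵢ⁆` (`aᵢ = (i, false)`, `bᵢ = (i, true)`, the letters of
  `Literature.Topology.FourManifolds.surfaceGen g`): the projection `proj`, generators `gen`, `a`,
  `b`, the relation `sum_lie_a_b`, the universal property `lift` / `hom_ext`, non-triviality
  `gen_ne_zero`; its pieces `grade R g n` (generated in degree one, `iSup_grade_eq_top`);
  `derDegree R g k = Der_k(𝔰_g)`; **`SurfaceLieAlgebraDer R g = Der⁺(𝔰_g(R))`**; for a set `C`
  of letters (a cut system) the **cut ideal** `cutIdeal R g C = (gen '' C)` and its stabilisers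
  `cutStabilizer` (in `Der⁺`) and `cutStabilizerDegree … n` (in `Der_n`), with
  `mem_derStabilizer_cutIdeal_iff` (stabilising `I_C` is checked on the letters of `C`);
  `s4CutSystem m i`, the three coordinate cut systems of the `m`-fold stabilised genus-`3`
  trisection of `S⁴` (`Literature.Topology.FourManifolds.s4Gens`, repeated in blocks of three
  handles), in genus `3 + 3m`.
* NAMED FACT `Labute1970_grSurfaceGroup`: the graded Lie ring of the lower central series of the
  surface group `Literature.Topology.FourManifolds.SurfaceGroup g` is `𝔰_g(ℤ)` (Labute 1970).

## Sources

* J. P. Labute, *On the descending central series of groups with a single defining relation*,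
  J. Algebra 14 (1970) 16–23: §1 Theorem (p. 17: for a primitive relator `r` of weight `e`,
  `gr(F/R) = gr(F)/𝔯`, `𝔯` the ideal generated by the initial form `ρ ∈ gr_e(F)`, and `grₙ` free
  of rank `gₙ`, `1 - m t + t^e = ∏ₙ (1 - tⁿ)^{gₙ}` (Prop. 4)); §2.2 (the one-relator Lie algebra
  `𝔤 = L/(ρ)`).
* W. Magnus, A. Karrass, D. Solitar, *Combinatorial Group Theory*, Ch. 5 (free Lie algebra by
  bracket length, lower central series of free groups; background only).

## Design choices / what is NOT here

* The grading is carried as the family of pieces `grade R g : ℕ → Submodule R 𝔰_g` with the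
  homogeneity instance; that the pieces form a direct sum (`DirectSum.IsInternal`, hence a
  Mathlib `GradedLieAlgebra` structure) holds because `ω` is homogeneous of degree `2` but is not
  proved here (it needs the word-length grading of `FreeLieAlgebra`, absent from Mathlib). All
  statements the requester needs ("in every degree `n`") are about the submodules
  `cutStabilizerDegree R g C n ≤ derDegree R g n` and do not use the decomposition.
* `Der⁺` is the internal sum `⨆ₖ Der_{k+1}` inside Mathlib's derivation Lie algebra; stabilisers
  are Lie subalgebras of the same ambient algebra, so `+`, `∩` of the informal statement are
  `⊔`, `⊓` of submodules of `LieDerivation R 𝔰_g 𝔰_g`.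
* Labute's theorem is vendored for the surface relator only and without constructing `gr(G)` as
  a Lie ring: it is stated through degree-wise maps `θₙ : S_g → 𝔰_g(ℤ)` (additive on `γₙ₊₁`,
  image `𝔰_g(ℤ)ₙ₊₁`, kernel `γₙ₊₂`, generators to generators, commutators to brackets), which is
  equivalent to a graded Lie ring isomorphism `gr(S_g) ≅ 𝔰_g(ℤ)` extending `aᵢ ↦ aᵢ, bᵢ ↦ bᵢ`.
  TODO(general form): arbitrary primitive one-relator groups and the rank formula.
-/

noncomputable section

namespace Literature.Algebra.Lie

/-! ## Bracket-length grading of a Lie algebra generated by a family -/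

section BracketLength

variable (R : Type*) [CommRing R] {X : Type*} {L : Type*} [LieRing L] [LieAlgebra R L]

/-- The iterated bracket `⟦w⟧_f ∈ L` of a non-associative word `w` in letters `X`, evaluated on a
family `f : X → L`: `⟦x⟧ = f x`, `⟦u v⟧ = ⁅⟦u⟧, ⟦v⟧⁆`. [folklore] -/
def bracketWord (f : X → L) : FreeMagma X → L
  | FreeMagma.of x => f x
  | u * v => ⁅bracketWord f u, bracketWord f v⁆

/-- `⟦x⟧ = f x`. [folklore] -/
@[simp] theorem bracketWord_of (f : X → L) (x : X) : bracketWord f (FreeMagma.of x) = f x := rfl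

/-- `⟦u v⟧ = ⁅⟦u⟧, ⟦v⟧⁆`. [folklore] -/
@[simp] theorem bracketWord_mul (f : X → L) (u v : FreeMagma X) :
    bracketWord f (u * v) = ⁅bracketWord f u, bracketWord f v⁆ := rfl

/-- Lie homomorphisms commute with iterated brackets. [folklore] -/
theorem map_bracketWord {L' : Type*} [LieRing L'] [LieAlgebra R L'] (φ : L →ₗ⁅R⁆ L') (f : X → L)
    (w : FreeMagma X) : φ (bracketWord f w) = bracketWord (φ ∘ f) w := by
  induction w using FreeMagma.recOnMul with
  | ih1 x => rfl
  | ih2 u v hu hv => simp [hu, hv]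

/-- The **bracket-length `n` piece** of `L` relative to a generating family `f : X → L`: the
`R`-span of the iterated brackets of words of length `n` in the `f x`. For the free Lie algebra on
`X` (and `f = FreeLieAlgebra.of R`) this is its standard `ℕ`-grading; for a quotient by an ideal
generated by bracket-homogeneous elements it is the induced grading (Magnus–Karrass–Solitar,
*Combinatorial Group Theory*, Ch. 5). [folklore] -/
def wordGrade (f : X → L) (n : ℕ) : Submodule R L :=
  Submodule.span R (bracketWord f '' {w | w.length = n})

variable {R}

/-- A word of length `n` brackets into `L_n`. [folklore] -/
theorem bracketWord_mem_wordGrade (f : X → L) (w : FreeMagma X) :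
    bracketWord f w ∈ wordGrade R f w.length :=
  Submodule.subset_span ⟨w, rfl, rfl⟩

/-- Generators have degree one. [folklore] -/
theorem mem_wordGrade_one (f : X → L) (x : X) : f x ∈ wordGrade R f 1 :=
  bracketWord_mem_wordGrade f (FreeMagma.of x)

/-- The pieces are bracket-homogeneous: `⁅L_m, L_n⁆ ⊆ L_{m+n}`. [folklore] -/
theorem lie_mem_wordGrade {f : X → L} {m n : ℕ} {x y : L} (hx : x ∈ wordGrade R f m)
    (hy : y ∈ wordGrade R f n) : ⁅x, y⁆ ∈ wordGrade R f (m + n) := by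
  refine Submodule.span_induction
    (p := fun x _ => ∀ y ∈ wordGrade R f n, ⁅x, y⁆ ∈ wordGrade R f (m + n)) ?_ ?_ ?_ ?_ hx y hy
  · rintro _ ⟨u, hu, rfl⟩ y hy
    refine Submodule.span_induction (p := fun y _ => ⁅bracketWord f u, y⁆ ∈ wordGrade R f (m + n))
      ?_ ?_ ?_ ?_ hy
    · rintro _ ⟨v, hv, rfl⟩
      refine Submodule.subset_span ⟨u * v, ?_, rfl⟩
      change u.length = m at hu
      change v.length = n at hv
      change u.length + v.length = m + n
      rw [hu, hv]
    · simp
    · intro y z _ _ hy hz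
      rw [lie_add]; exact add_mem hy hz
    · intro c y _ hy
      rw [lie_smul]; exact Submodule.smul_mem _ c hy
  · intro y _; simp
  · intro x x' _ _ hx hx' y hy
    rw [add_lie]; exact add_mem (hx y hy) (hx' y hy)
  · intro c x _ hx y hy
    rw [smul_lie]; exact Submodule.smul_mem _ c (hx y hy)

/-- `wordGrade R f` is a `SetLike.GradedBracket` family (Mathlib's homogeneity class). [folklore] -/
instance wordGrade.gradedBracket (f : X → L) : SetLike.GradedBracket (wordGrade R f) :=
  ⟨fun _ _ _ _ hx hy => lie_mem_wordGrade hx hy⟩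

/-- There are no words of length `0`. [folklore] -/
theorem wordGrade_zero (f : X → L) : wordGrade R f 0 = ⊥ := by
  rw [wordGrade, Submodule.span_eq_bot]
  rintro _ ⟨w, hw, rfl⟩
  exact absurd hw (FreeMagma.length_pos w).ne'

/-- Degree one is spanned by the generators. [folklore] -/
theorem wordGrade_one (f : X → L) : wordGrade R f 1 = Submodule.span R (Set.range f) := by
  refine le_antisymm (Submodule.span_le.2 ?_) (Submodule.span_le.2 ?_)
  · rintro _ ⟨w, hw, rfl⟩
    induction w using FreeMagma.recOnMul with
    | ih1 x => exact Submodule.subset_span ⟨x, rfl⟩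
    | ih2 u v _ _ =>
      exfalso
      have hu := FreeMagma.length_pos u
      have hv := FreeMagma.length_pos v
      change u.length + v.length = 1 at hw
      omega
  · rintro _ ⟨x, rfl⟩
    exact mem_wordGrade_one f x

/-- Lie homomorphisms map pieces onto pieces: `φ(L_n(f)) = L'_n(φ ∘ f)`. [folklore] -/
theorem map_wordGrade {L' : Type*} [LieRing L'] [LieAlgebra R L'] (φ : L →ₗ⁅R⁆ L') (f : X → L)
    (n : ℕ) : (wordGrade R f n).map (φ : L →ₗ[R] L') = wordGrade R (φ ∘ f) n := by
  rw [wordGrade, Submodule.map_span, ← Set.image_comp]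
  congr 1
  ext w
  -- pointwise `φ ∘ bracketWord f = bracketWord (φ ∘ f)`
  simp only [Set.mem_image, Function.comp_apply, LieHom.coe_toLinearMap, map_bracketWord]

/-- The sum of all pieces is closed under the bracket. [folklore] -/
theorem lie_mem_iSup_wordGrade {f : X → L} {x y : L} (hx : x ∈ ⨆ n, wordGrade R f n)
    (hy : y ∈ ⨆ n, wordGrade R f n) : ⁅x, y⁆ ∈ ⨆ n, wordGrade R f n := by
  refine Submodule.iSup_induction _ (motive := fun x => ∀ y ∈ ⨆ n, wordGrade R f n,
    ⁅x, y⁆ ∈ ⨆ n, wordGrade R f n) hx ?_ ?_ ?_ y hy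
  · intro m x hx y hy
    refine Submodule.iSup_induction _ (motive := fun y => ⁅x, y⁆ ∈ ⨆ n, wordGrade R f n) hy
      ?_ ?_ ?_
    · intro n y hy
      exact Submodule.mem_iSup_of_mem (m + n) (lie_mem_wordGrade hx hy)
    · simp
    · intro y z hy hz; rw [lie_add]; exact add_mem hy hz
  · intro y _; simp
  · intro x x' hx hx' y hy; rw [add_lie]; exact add_mem (hx y hy) (hx' y hy)

/-- The sum of all pieces, as a Lie subalgebra. [folklore] -/
def wordGradeSubalgebra (f : X → L) : LieSubalgebra R L :=
  { (⨆ n, wordGrade R f n : Submodule R L) with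
    lie_mem' := fun hx hy => lie_mem_iSup_wordGrade hx hy }

/-- Membership in `wordGradeSubalgebra`. [folklore] -/
theorem mem_wordGradeSubalgebra (f : X → L) (x : L) :
    x ∈ wordGradeSubalgebra f (R := R) ↔ x ∈ ⨆ n, wordGrade R f n := Iff.rfl

/-- If the family generates `L` as a Lie algebra, the pieces span `L`. [folklore] -/
theorem iSup_wordGrade_eq_top {f : X → L} (hf : LieSubalgebra.lieSpan R L (Set.range f) = ⊤) :
    (⨆ n, wordGrade R f n) = ⊤ := by
  have h : LieSubalgebra.lieSpan R L (Set.range f) ≤ wordGradeSubalgebra f (R := R) := by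
    rw [LieSubalgebra.lieSpan_le]
    rintro _ ⟨x, rfl⟩
    exact Submodule.mem_iSup_of_mem 1 (mem_wordGrade_one f x)
  rw [hf] at h
  exact eq_top_iff.2 fun x _ => (mem_wordGradeSubalgebra f x).1 (h (LieSubalgebra.mem_top x))

end BracketLength

/-! ## Homogeneous derivations, positive-degree derivations, stabilisers -/

section Derivations

variable {R : Type*} [CommRing R] {L : Type*} [LieRing L] [LieAlgebra R L]
variable {ι : Type*} [AddCommMonoid ι]

/-- The **derivations of degree `k`** of `L` relative to a family of pieces `ℒ : ι → Submodule R L`: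
`Der_k = {D | D(ℒ_i) ⊆ ℒ_{i+k} for all i}`, an `R`-submodule of `Der(L) = LieDerivation R L L`.
[folklore] -/
def derOfDegree (ℒ : ι → Submodule R L) (k : ι) : Submodule R (LieDerivation R L L) where
  carrier := {D | ∀ i, ∀ x ∈ ℒ i, D x ∈ ℒ (i + k)}
  zero_mem' := fun i x _ => by simp
  add_mem' := fun {D E} hD hE i x hx => by
    rw [LieDerivation.add_apply]; exact add_mem (hD i x hx) (hE i x hx)
  smul_mem' := fun c D hD i x hx => by
    rw [LieDerivation.smul_apply]; exact Submodule.smul_mem _ c (hD i x hx)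

/-- Membership in `Der_k`. [folklore] -/
theorem mem_derOfDegree {ℒ : ι → Submodule R L} {k : ι} {D : LieDerivation R L L} :
    D ∈ derOfDegree ℒ k ↔ ∀ i, ∀ x ∈ ℒ i, D x ∈ ℒ (i + k) := Iff.rfl

/-- `⁅Der_k, Der_l⁆ ⊆ Der_{k+l}`. [folklore] -/
theorem lie_mem_derOfDegree {ℒ : ι → Submodule R L} {k l : ι} {D E : LieDerivation R L L}
    (hD : D ∈ derOfDegree ℒ k) (hE : E ∈ derOfDegree ℒ l) : ⁅D, E⁆ ∈ derOfDegree ℒ (k + l) := by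
  intro i x hx
  rw [LieDerivation.lie_apply]
  refine sub_mem ?_ ?_
  · have := hD (i + l) (E x) (hE i x hx); rwa [add_assoc, add_comm l] at this
  · have := hE (i + k) (D x) (hD i x hx); rwa [add_assoc] at this

/-- `derOfDegree ℒ` is a `SetLike.GradedBracket` family on `Der(L)`. [folklore] -/
instance derOfDegree.gradedBracket (ℒ : ι → Submodule R L) :
    SetLike.GradedBracket (derOfDegree ℒ) :=
  ⟨fun _ _ _ _ hD hE => lie_mem_derOfDegree hD hE⟩

/-- The sum of the positive-degree pieces `⨆_{k ≥ 1} Der_k` is closed under the bracket.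
[folklore] -/
theorem lie_mem_iSup_derOfDegree_succ {ℒ : ℕ → Submodule R L} {D E : LieDerivation R L L}
    (hD : D ∈ ⨆ k, derOfDegree ℒ (k + 1)) (hE : E ∈ ⨆ k, derOfDegree ℒ (k + 1)) :
    ⁅D, E⁆ ∈ ⨆ k, derOfDegree ℒ (k + 1) := by
  refine Submodule.iSup_induction _ (motive := fun D => ∀ E ∈ ⨆ k, derOfDegree ℒ (k + 1),
    ⁅D, E⁆ ∈ ⨆ k, derOfDegree ℒ (k + 1)) hD ?_ ?_ ?_ E hE
  · intro k D hD E hE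
    refine Submodule.iSup_induction _ (motive := fun E => ⁅D, E⁆ ∈ ⨆ k, derOfDegree ℒ (k + 1))
      hE ?_ ?_ ?_
    · intro l E hE
      refine Submodule.mem_iSup_of_mem (k + l + 1) ?_
      have := lie_mem_derOfDegree hD hE
      rwa [show k + 1 + (l + 1) = k + l + 1 + 1 by ring] at this
    · simp
    · intro E E' hE hE'; rw [lie_add]; exact add_mem hE hE'
  · intro E _; simp
  · intro D D' hD hD' E hE; rw [add_lie]; exact add_mem (hD E hE) (hD' E hE)

/-- **`Der⁺`**: the Lie subalgebra of positive-degree derivations `⨆_{k ≥ 1} Der_k(ℒ)` of an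
`ℕ`-graded (or `ℕ`-filtered-by-pieces) Lie algebra. [folklore] -/
def derPos (ℒ : ℕ → Submodule R L) : LieSubalgebra R (LieDerivation R L L) :=
  { (⨆ k, derOfDegree ℒ (k + 1) : Submodule R (LieDerivation R L L)) with
    lie_mem' := fun hD hE => lie_mem_iSup_derOfDegree_succ hD hE }

/-- Membership in `Der⁺`. [folklore] -/
theorem mem_derPos {ℒ : ℕ → Submodule R L} {D : LieDerivation R L L} :
    D ∈ derPos ℒ ↔ D ∈ ⨆ k, derOfDegree ℒ (k + 1) := Iff.rfl

/-- `Der_{k+1} ⊆ Der⁺`. [folklore] -/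
theorem derOfDegree_succ_le_derPos (ℒ : ℕ → Submodule R L) (k : ℕ) :
    derOfDegree ℒ (k + 1) ≤ (derPos ℒ).toSubmodule :=
  le_iSup (fun k => derOfDegree ℒ (k + 1)) k

/-- The **stabiliser** `Stab(N) = {D ∈ Der(L) | D(N) ⊆ N}` of a submodule (e.g. an ideal) `N`
in the derivation algebra; a Lie subalgebra. [folklore] -/
def derStabilizer (N : Submodule R L) : LieSubalgebra R (LieDerivation R L L) where
  carrier := {D | ∀ x ∈ N, D x ∈ N}
  zero_mem' := fun x _ => by simp
  add_mem' := fun {D E} hD hE x hx => by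
    rw [LieDerivation.add_apply]; exact add_mem (hD x hx) (hE x hx)
  smul_mem' := fun c D hD x hx => by
    rw [LieDerivation.smul_apply]; exact Submodule.smul_mem _ c (hD x hx)
  lie_mem' := fun {D E} hD hE x hx => by
    rw [LieDerivation.lie_apply]; exact sub_mem (hD _ (hE x hx)) (hE _ (hD x hx))

/-- Membership in a stabiliser. [folklore] -/
theorem mem_derStabilizer {N : Submodule R L} {D : LieDerivation R L L} :
    D ∈ derStabilizer N ↔ ∀ x ∈ N, D x ∈ N := Iff.rfl

/-- Inner derivations `ad(m) : x ↦ ⁅x, m⁆` by an element of degree `k` have degree `k`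
(for a bracket-homogeneous family of pieces). [folklore] -/
theorem inner_mem_derOfDegree {ℒ : ι → Submodule R L} [SetLike.GradedBracket ℒ] {k : ι} {m : L}
    (hm : m ∈ ℒ k) : LieDerivation.inner R L L m ∈ derOfDegree ℒ k := fun i x hx => by
  rw [LieDerivation.inner_apply_apply]
  exact SetLike.GradedBracket.bracket_mem hx hm

/-- Inner derivations stabilise every Lie ideal. [folklore] -/
theorem inner_mem_derStabilizer (I : LieIdeal R L) (m : L) :
    LieDerivation.inner R L L m ∈ derStabilizer I.toSubmodule := fun x hx => by
  rw [LieDerivation.inner_apply_apply]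
  exact lie_mem_left R L I x m hx

/-- A derivation stabilises the Lie ideal generated by a set as soon as it maps the set into
the ideal. [folklore] -/
theorem mem_derStabilizer_lieSpan {s : Set L} {D : LieDerivation R L L}
    (h : ∀ x ∈ s, D x ∈ LieSubmodule.lieSpan R L s) :
    D ∈ derStabilizer (LieSubmodule.lieSpan R L s : LieIdeal R L).toSubmodule := by
  intro x hx
  -- the elements mapped into the ideal form a Lie ideal containing `s`
  let I : LieIdeal R L := LieSubmodule.lieSpan R L s
  let J : LieIdeal R L :=
    { (I : Submodule R L).comap (D : L →ₗ[R] L) ⊓ (I : Submodule R L) with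
      lie_mem := by
        rintro y z ⟨hz, hz'⟩
        refine ⟨?_, lie_mem_right R L I y z hz'⟩
        change D ⁅y, z⁆ ∈ I
        rw [LieDerivation.apply_lie_eq_sub]
        exact sub_mem (lie_mem_right R L I y _ hz) (lie_mem_left R L I z _ hz') }
  have hJ : I ≤ J := by
    rw [LieSubmodule.lieSpan_le]
    intro y hy
    exact ⟨h y hy, LieSubmodule.subset_lieSpan hy⟩
  exact (hJ hx).1

end Derivations

/-! ## The surface Lie algebra `𝔰_g(R)` -/

section Surface

variable (R : Type*) [CommRing R] (g : ℕ)

/-- The **symplectic element** `ω = ∑ᵢ ⁅aᵢ, bᵢ⁆` of the free Lie algebra on the `2g` letters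
`aᵢ = (i, false)`, `bᵢ = (i, true)` (`i : Fin g`; the letters are
`Literature.Topology.FourManifolds.surfaceGen g = Fin g × Bool`): the initial form of the surface
relator `∏ᵢ [aᵢ, bᵢ]` (Labute's `ρ`, the image of the relator `r` in `gr_e(F)`, here `e = 2`).
[cite: Labute1970, §1 Theorem p. 17 (the initial form ρ)] -/
def surfaceOmega : FreeLieAlgebra R (Fin g × Bool) :=
  ∑ i : Fin g, ⁅FreeLieAlgebra.of R ((i, false) : Fin g × Bool), FreeLieAlgebra.of R (i, true)⁆

/-- The Lie ideal `𝔯 = (ω)` generated by `ω`.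
[cite: Labute1970, §2.2 p. 18 (the ideal 𝔯 generated by ρ)] -/
def surfaceOmegaIdeal : LieIdeal R (FreeLieAlgebra R (Fin g × Bool)) :=
  LieSubmodule.lieSpan R (FreeLieAlgebra R (Fin g × Bool)) {surfaceOmega R g}

/-- The **surface Lie algebra** `𝔰_g(R) = FreeLie_R(a₁, b₁, …, a_g, b_g) ⧸ (∑ᵢ ⁅aᵢ, bᵢ⁆)`, the Lie
algebra with the single defining relation `ω = 0` (Labute's `𝔤 = L/𝔯` for `ρ = ω` over the
`2g` letters `Fin g × Bool`); over `ℤ` it is the graded Lie ring of the lower central series of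
the surface group `π₁(Σ_g)` (Labute 1970, §1 Theorem; see `Labute1970_grSurfaceGroup`).
[cite: Labute1970, §2.2 p. 18 (the one-relator Lie algebra 𝔤 = L/𝔯)] -/
abbrev SurfaceLieAlgebra : Type _ :=
  FreeLieAlgebra R (Fin g × Bool) ⧸ surfaceOmegaIdeal R g

namespace SurfaceLieAlgebra

/-- The quotient map `FreeLie_R(aᵢ, bᵢ) → 𝔰_g(R)` as a morphism of Lie algebras. [folklore] -/
def proj : FreeLieAlgebra R (Fin g × Bool) →ₗ⁅R⁆ SurfaceLieAlgebra R g :=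
  { (LieSubmodule.Quotient.mk' (surfaceOmegaIdeal R g) :
      FreeLieAlgebra R (Fin g × Bool) →ₗ[R] SurfaceLieAlgebra R g) with
    map_lie' := fun {_ _} => rfl }

/-- `proj` is the quotient map. [folklore] -/
theorem proj_apply (x : FreeLieAlgebra R (Fin g × Bool)) :
    proj R g x = LieSubmodule.Quotient.mk (N := surfaceOmegaIdeal R g) x := rfl

/-- `proj` is onto. [folklore] -/
theorem proj_surjective : Function.Surjective (proj R g) :=
  LieSubmodule.Quotient.surjective_mk' _

/-- The generator of `𝔰_g(R)` attached to a letter. [folklore] -/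
def gen (x : Fin g × Bool) : SurfaceLieAlgebra R g := proj R g (FreeLieAlgebra.of R x)

/-- `aᵢ ∈ 𝔰_g(R)`. [folklore] -/
def a (i : Fin g) : SurfaceLieAlgebra R g := gen R g (i, false)

/-- `bᵢ ∈ 𝔰_g(R)`. [folklore] -/
def b (i : Fin g) : SurfaceLieAlgebra R g := gen R g (i, true)

/-- `proj` of a letter is the corresponding generator. [folklore] -/
@[simp] theorem proj_of (x : Fin g × Bool) : proj R g (FreeLieAlgebra.of R x) = gen R g x := rfl

/-- `ω ↦ 0`. [folklore] -/
theorem proj_surfaceOmega : proj R g (surfaceOmega R g) = 0 :=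
  (LieSubmodule.Quotient.mk_eq_zero' (N := surfaceOmegaIdeal R g)).2
    (LieSubmodule.subset_lieSpan rfl)

/-- **The defining relation** `∑ᵢ ⁅aᵢ, bᵢ⁆ = 0` in `𝔰_g(R)`. [folklore] -/
theorem sum_lie_a_b : ∑ i : Fin g, ⁅a R g i, b R g i⁆ = 0 := by
  have h := proj_surfaceOmega R g
  simpa only [surfaceOmega, map_sum, LieHom.map_lie, proj_of, a, b] using h

variable {R g}
variable {L : Type*} [LieRing L] [LieAlgebra R L]

/-- A family satisfying the relation kills the ideal `(ω)`. [folklore] -/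
theorem surfaceOmegaIdeal_le_ker (f : Fin g × Bool → L)
    (hf : ∑ i : Fin g, ⁅f (i, false), f (i, true)⁆ = 0) :
    surfaceOmegaIdeal R g ≤ (FreeLieAlgebra.lift R f).ker := by
  rw [surfaceOmegaIdeal, LieSubmodule.lieSpan_le, Set.singleton_subset_iff, SetLike.mem_coe,
    LieHom.mem_ker]
  simp only [surfaceOmega, map_sum, LieHom.map_lie, FreeLieAlgebra.lift_of_apply, hf]

/-- **Universal property**: a family `f : Fin g × Bool → L` with `∑ᵢ ⁅f aᵢ, f bᵢ⁆ = 0` extends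
(uniquely, `hom_ext`) to a Lie algebra morphism `𝔰_g(R) → L`. [folklore] -/
def lift (f : Fin g × Bool → L) (hf : ∑ i : Fin g, ⁅f (i, false), f (i, true)⁆ = 0) :
    SurfaceLieAlgebra R g →ₗ⁅R⁆ L :=
  { (surfaceOmegaIdeal R g).toSubmodule.liftQ
      (FreeLieAlgebra.lift R f : FreeLieAlgebra R (Fin g × Bool) →ₗ[R] L)
      (fun x hx => (FreeLieAlgebra.lift R f).mem_ker.1 (surfaceOmegaIdeal_le_ker f hf hx)) with
    map_lie' := by
      rintro ⟨x⟩ ⟨y⟩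
      exact (FreeLieAlgebra.lift R f).map_lie x y }

/-- `lift f` extends `f`. [folklore] -/
@[simp] theorem lift_gen (f : Fin g × Bool → L)
    (hf : ∑ i : Fin g, ⁅f (i, false), f (i, true)⁆ = 0) (x : Fin g × Bool) :
    lift f hf (gen R g x) = f x :=
  FreeLieAlgebra.lift_of_apply f x

/-- `lift f ∘ proj` is the free lift of `f`. [folklore] -/
theorem lift_comp_proj (f : Fin g × Bool → L)
    (hf : ∑ i : Fin g, ⁅f (i, false), f (i, true)⁆ = 0) :
    (lift f hf).comp (proj R g) = FreeLieAlgebra.lift R f :=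
  FreeLieAlgebra.hom_ext fun x => by
    rw [LieHom.comp_apply, proj_of, lift_gen, FreeLieAlgebra.lift_of_apply]

/-- Two morphisms out of `𝔰_g(R)` agreeing on the generators are equal. [folklore] -/
theorem hom_ext {φ ψ : SurfaceLieAlgebra R g →ₗ⁅R⁆ L} (h : ∀ x, φ (gen R g x) = ψ (gen R g x)) :
    φ = ψ := by
  have : φ.comp (proj R g) = ψ.comp (proj R g) := FreeLieAlgebra.hom_ext h
  ext y
  obtain ⟨x, rfl⟩ := proj_surjective R g y
  exact LieHom.congr_fun this x

variable (R g) in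
/-- `𝔰_g(R)` is not degenerate: its generators are non-zero (map them to `1` in the abelian Lie
algebra `R`). [folklore] -/
theorem gen_ne_zero [Nontrivial R] (x : Fin g × Bool) : gen R g x ≠ 0 := by
  letI : LieRing R := LieRing.ofAssociativeRing
  letI : LieAlgebra R R := LieAlgebra.ofAssociativeAlgebra
  intro hx
  have h := lift_gen (R := R) (g := g) (L := R) (fun _ => (1 : R)) (by simp) x
  rw [hx, map_zero] at h
  exact zero_ne_one h

variable (R g)

/-! ### The grading by bracket length -/

/-- The **degree-`n` piece** `𝔰_g(R)_n`: the span of the `n`-fold brackets of generators (the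
image of the degree-`n` piece of the free Lie algebra, `grade_eq_map`; `𝔰_g = ⊕ₙ 𝔰_g,ₙ` since
`ω` is homogeneous of degree `2` — the direct-sum property is not proved here). Over `ℤ`,
`𝔰_g(ℤ)ₙ ≅ γₙ π₁Σ_g / γₙ₊₁ π₁Σ_g` (Labute 1970, see `Labute1970_grSurfaceGroup`). [folklore] -/
def grade (n : ℕ) : Submodule R (SurfaceLieAlgebra R g) := wordGrade R (gen R g) n

/-- `𝔰_g(R)_n` is the image of the degree-`n` piece of the free Lie algebra. [folklore] -/
theorem grade_eq_map (n : ℕ) : grade R g n =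
    (wordGrade R (FreeLieAlgebra.of R) n).map
      (proj R g : FreeLieAlgebra R (Fin g × Bool) →ₗ[R] SurfaceLieAlgebra R g) := by
  rw [map_wordGrade]; rfl

/-- Generators have degree one. [folklore] -/
theorem gen_mem_grade_one (x : Fin g × Bool) : gen R g x ∈ grade R g 1 := mem_wordGrade_one _ x

/-- `𝔰_g(R)_0 = 0`. [folklore] -/
theorem grade_zero : grade R g 0 = ⊥ := wordGrade_zero _

/-- `⁅𝔰_m, 𝔰_n⁆ ⊆ 𝔰_{m+n}`. [folklore] -/
theorem lie_mem_grade {m n : ℕ} {x y : SurfaceLieAlgebra R g} (hx : x ∈ grade R g m)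
    (hy : y ∈ grade R g n) : ⁅x, y⁆ ∈ grade R g (m + n) := lie_mem_wordGrade hx hy

/-- The pieces of `𝔰_g(R)` are bracket-homogeneous (Mathlib `SetLike.GradedBracket`). [folklore] -/
instance grade.gradedBracket : SetLike.GradedBracket (grade R g) := wordGrade.gradedBracket _

/-- The free Lie algebra is generated by its letters. [folklore] -/
theorem _root_.Literature.Algebra.Lie.lieSpan_range_freeLieAlgebraOf (X : Type*) :
    LieSubalgebra.lieSpan R (FreeLieAlgebra R X) (Set.range (FreeLieAlgebra.of R)) = ⊤ := by
  set K := LieSubalgebra.lieSpan R (FreeLieAlgebra R X) (Set.range (FreeLieAlgebra.of R))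
  let F : FreeLieAlgebra R X →ₗ⁅R⁆ K :=
    FreeLieAlgebra.lift R fun x => ⟨FreeLieAlgebra.of R x, LieSubalgebra.subset_lieSpan ⟨x, rfl⟩⟩
  have hF : K.incl.comp F = LieHom.id := FreeLieAlgebra.hom_ext fun x => by simp [F]
  refine eq_top_iff.2 fun y _ => ?_
  have hy : K.incl (F y) = y := LieHom.congr_fun hF y
  rw [← hy]
  exact (F y).2

/-- `𝔰_g(R)` is generated by the `gen x` as a Lie algebra. [folklore] -/
theorem lieSpan_range_gen :
    LieSubalgebra.lieSpan R (SurfaceLieAlgebra R g) (Set.range (gen R g)) = ⊤ := by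
  refine eq_top_iff.2 fun y _ => ?_
  obtain ⟨x, rfl⟩ := proj_surjective R g y
  have hx : x ∈ (LieSubalgebra.lieSpan R _ (Set.range (gen R g))).comap (proj R g) := by
    rw [← LieSubalgebra.mem_toSubmodule] -- harmless normalisation
    have : LieSubalgebra.lieSpan R _ (Set.range (FreeLieAlgebra.of R)) ≤
        (LieSubalgebra.lieSpan R _ (Set.range (gen R g))).comap (proj R g) := by
      rw [LieSubalgebra.lieSpan_le]
      rintro _ ⟨z, rfl⟩
      exact LieSubalgebra.subset_lieSpan ⟨z, rfl⟩
    exact this (by rw [lieSpan_range_freeLieAlgebraOf]; exact LieSubalgebra.mem_top x)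
  exact hx

/-- The pieces span: `∑ₙ 𝔰_g(R)_n = 𝔰_g(R)`. [folklore] -/
theorem iSup_grade_eq_top : (⨆ n, grade R g n) = ⊤ :=
  iSup_wordGrade_eq_top (lieSpan_range_gen R g)

/-! ### Derivations: `Der_k(𝔰_g)`, `Der⁺(𝔰_g)`, cut ideals and their stabilisers -/

/-- `Der_k(𝔰_g(R))`: derivations raising bracket length by `k`. [folklore] -/
abbrev derDegree (k : ℕ) :
    Submodule R (LieDerivation R (SurfaceLieAlgebra R g) (SurfaceLieAlgebra R g)) :=
  derOfDegree (grade R g) k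

end SurfaceLieAlgebra

/-- **`Der⁺(𝔰_g(R))`**, the Lie algebra of positive-degree derivations of the surface Lie algebra:
the Lie subalgebra `∑_{k ≥ 1} Der_k(𝔰_g(R))` of `Der(𝔰_g(R)) = LieDerivation R 𝔰_g 𝔰_g`
(the definition-request notion `SurfaceLieAlgebraDer`). [folklore] -/
def SurfaceLieAlgebraDer :
    LieSubalgebra R (LieDerivation R (SurfaceLieAlgebra R g) (SurfaceLieAlgebra R g)) :=
  derPos (SurfaceLieAlgebra.grade R g)

namespace SurfaceLieAlgebra

/-- `Der_{k+1}(𝔰_g) ⊆ Der⁺(𝔰_g)`. [folklore] -/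
theorem derDegree_succ_le_der (k : ℕ) :
    derDegree R g (k + 1) ≤ (SurfaceLieAlgebraDer R g).toSubmodule :=
  derOfDegree_succ_le_derPos _ k

/-- The **cut ideal** `I_C ⊴ 𝔰_g(R)` generated by a set `C` of letters (a cut system, e.g. the
`a`-letters, or the pattern `Literature.Topology.FourManifolds.s4Gens i`). [folklore] -/
def cutIdeal (C : Set (Fin g × Bool)) : LieIdeal R (SurfaceLieAlgebra R g) :=
  LieSubmodule.lieSpan R (SurfaceLieAlgebra R g) (gen R g '' C)

/-- The letters of `C` lie in `I_C`. [folklore] -/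
theorem gen_mem_cutIdeal {C : Set (Fin g × Bool)} {x : Fin g × Bool} (hx : x ∈ C) :
    gen R g x ∈ cutIdeal R g C :=
  LieSubmodule.subset_lieSpan ⟨x, hx, rfl⟩

/-- The **stabiliser** `Stab(I_C) = {D ∈ Der⁺(𝔰_g) | D(I_C) ⊆ I_C}` of a cut ideal in `Der⁺`.
[folklore] -/
def cutStabilizer (C : Set (Fin g × Bool)) :
    LieSubalgebra R (LieDerivation R (SurfaceLieAlgebra R g) (SurfaceLieAlgebra R g)) :=
  SurfaceLieAlgebraDer R g ⊓ derStabilizer (cutIdeal R g C).toSubmodule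

/-- The degree-`n` part `Stab(I_C) ∩ Der_n` of a stabiliser (an `R`-submodule of `Der(𝔰_g)`).
[folklore] -/
def cutStabilizerDegree (C : Set (Fin g × Bool)) (n : ℕ) :
    Submodule R (LieDerivation R (SurfaceLieAlgebra R g) (SurfaceLieAlgebra R g)) :=
  (derStabilizer (cutIdeal R g C).toSubmodule).toSubmodule ⊓ derDegree R g n

/-- Membership in `Stab(I_C)`. [folklore] -/
theorem mem_cutStabilizer_iff {C : Set (Fin g × Bool)}
    {D : LieDerivation R (SurfaceLieAlgebra R g) (SurfaceLieAlgebra R g)} :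
    D ∈ cutStabilizer R g C ↔
      D ∈ SurfaceLieAlgebraDer R g ∧ D ∈ derStabilizer (cutIdeal R g C).toSubmodule :=
  LieSubalgebra.mem_inf _ _ _

/-- Membership in `Stab(I_C) ∩ Der_n`. [folklore] -/
theorem mem_cutStabilizerDegree_iff {C : Set (Fin g × Bool)} {n : ℕ}
    {D : LieDerivation R (SurfaceLieAlgebra R g) (SurfaceLieAlgebra R g)} :
    D ∈ cutStabilizerDegree R g C n ↔
      D ∈ derStabilizer (cutIdeal R g C).toSubmodule ∧ D ∈ derDegree R g n :=
  Submodule.mem_inf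

/-- A derivation stabilises `I_C` iff it maps the generators in `C` into `I_C` (the finite check
behind the dimension counts). [folklore] -/
theorem mem_derStabilizer_cutIdeal_iff {C : Set (Fin g × Bool)}
    {D : LieDerivation R (SurfaceLieAlgebra R g) (SurfaceLieAlgebra R g)} :
    D ∈ derStabilizer (cutIdeal R g C).toSubmodule ↔ ∀ x ∈ C, D (gen R g x) ∈ cutIdeal R g C :=
  ⟨fun h x hx => h _ (gen_mem_cutIdeal R g hx),
    fun h => mem_derStabilizer_lieSpan (by rintro _ ⟨x, hx, rfl⟩; exact h x hx)⟩

/-- The positive-degree parts of the stabiliser lie in `Stab(I_C) ⊆ Der⁺`. [folklore] -/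
theorem cutStabilizerDegree_succ_le (C : Set (Fin g × Bool)) (n : ℕ) :
    cutStabilizerDegree R g C (n + 1) ≤ (cutStabilizer R g C).toSubmodule := by
  rintro D ⟨hD, hD'⟩
  exact ⟨derDegree_succ_le_der R g n hD', hD⟩

end SurfaceLieAlgebra

end Surface

/-! ## The coordinate cut systems of the stabilised `S⁴` trisection; Labute's theorem -/

section Labute

open Literature.Topology.FourManifolds
open scoped commutatorElement

/-- The three **coordinate cut systems in genus `3 + 3m`**: the letters killed by the `i`-th
kernel of the `m`-fold stabilisation `s4Kernels.stabilizeIter m` of the genus-`3` trisection of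
`S⁴` — the pattern `Literature.Topology.FourManifolds.s4Gens i` (`{a₁,a₂,b₃}`, `{a₁,b₂,a₃}`,
`{b₁,a₂,a₃}`) repeated on each block of three consecutive handles (stabilisation appends the
genus-`3` pattern on the three new handles, `TrisectionKernels.stabilize`, `genShift`). A letter
`(j, ε)` belongs iff `(j mod 3, ε) ∈ s4Gens i`. [folklore] -/
def s4CutSystem (m : ℕ) (i : Fin 3) : Set (Fin (3 + 3 * m) × Bool) :=
  {x | ((⟨(x.1 : ℕ) % 3, Nat.mod_lt _ (by decide)⟩ : Fin 3), x.2) ∈ s4Gens i}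

/-- In genus `3` (`m = 0`) the cut systems are the `s4Gens i` themselves. [folklore] -/
theorem s4CutSystem_zero (i : Fin 3) : s4CutSystem 0 i = ↑(s4Gens i) := by
  ext ⟨j, ε⟩
  simp only [s4CutSystem, Set.mem_setOf_eq, Finset.mem_coe]
  rw [show (⟨(j : ℕ) % 3, Nat.mod_lt _ (by decide)⟩ : Fin 3) = j from
    Fin.ext (Nat.mod_eq_of_lt j.is_lt)]

/-- NAMED FACT (**Labute 1970**, Theorem of §1, for the surface relator). Let `S_g = π₁(Σ_g)`
(`Literature.Topology.FourManifolds.SurfaceGroup g`, `g ≥ 1`) with lower central series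
`γ₁ = S_g`, `γₙ₊₁ = (γₙ, S_g)` — in Mathlib's indexing
`γₙ₊₁ = (⊤ : Subgroup S_g).lowerCentralSeries n`.
The relator `r = ∏ᵢ [aᵢ, bᵢ]` has weight `e = 2` and is primitive (its image
`ρ = ∑ᵢ [ξ_{aᵢ}, ξ_{bᵢ}]` in `gr₂(F)` is not a proper multiple), and `gr(F)` of the free group
on the `2g` letters is the free Lie ring on them (Magnus–Witt, quoted in Labute §1); hence, by the
Theorem ("𝔯 is the kernel of the canonical homomorphism of `gr(F)` onto `gr(G)`"), the graded Lie
ring `gr(S_g) = ⊕ₙ γₙ/γₙ₊₁` (bracket induced by the group commutator) is canonically isomorphic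
to `gr(F)/(ρ) = 𝔰_g(ℤ)`, `ξ_{aᵢ} ↦ aᵢ`, `ξ_{bᵢ} ↦ bᵢ`. Stated without building `gr(S_g)` as a
Lie ring: there are maps `θₙ : S_g → 𝔰_g(ℤ)` (`n ≥ 0`; only their values on `γₙ₊₁` matter) that
are additive on `γₙ₊₁`, have image `𝔰_g(ℤ)ₙ₊₁` and kernel `γₙ₊₂` there, send `aᵢ, bᵢ` to
`aᵢ, bᵢ` (`n = 0`), and turn group commutators `⁅x, y⁆ = x y x⁻¹ y⁻¹` (`x ∈ γₘ₊₁`, `y ∈ γₙ₊₁`,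
so `⁅x, y⁆ ∈ γₘ₊ₙ₊₂`, `Literature.NumberTheory.Sieve.HostKra.commutator_lowerCentralSeries_le`)
into Lie brackets. (Labute also proves that each `grₙ(S_g)` is free abelian, of rank `gₙ` with
`∏ₙ (1 - tⁿ)^{gₙ} = 1 - 2g·t + t²`; not vendored.) Users take `(h : Labute1970_grSurfaceGroup)`.
[cite: Labute1970, §1 Theorem p. 17 (with m = 2g letters; r = ∏[aᵢ bᵢ] of weight e = 2)] -/
def Labute1970_grSurfaceGroup : Prop :=
  ∀ g : ℕ, 0 < g →
    ∃ θ : ℕ → SurfaceGroup g → SurfaceLieAlgebra ℤ g,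
      (∀ n, ∀ x ∈ (⊤ : Subgroup (SurfaceGroup g)).lowerCentralSeries n,
        ∀ y ∈ (⊤ : Subgroup (SurfaceGroup g)).lowerCentralSeries n,
          θ n (x * y) = θ n x + θ n y) ∧
      (∀ n, θ n '' ((⊤ : Subgroup (SurfaceGroup g)).lowerCentralSeries n) =
        SurfaceLieAlgebra.grade ℤ g (n + 1)) ∧
      (∀ n, ∀ x ∈ (⊤ : Subgroup (SurfaceGroup g)).lowerCentralSeries n,
        θ n x = 0 ↔ x ∈ (⊤ : Subgroup (SurfaceGroup g)).lowerCentralSeries (n + 1)) ∧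
      (∀ i, θ 0 (SurfaceGroup.a i) = SurfaceLieAlgebra.a ℤ g i) ∧
      (∀ i, θ 0 (SurfaceGroup.b i) = SurfaceLieAlgebra.b ℤ g i) ∧
      (∀ m n, ∀ x ∈ (⊤ : Subgroup (SurfaceGroup g)).lowerCentralSeries m,
        ∀ y ∈ (⊤ : Subgroup (SurfaceGroup g)).lowerCentralSeries n,
          θ (m + n + 1) ⁅x, y⁆ = ⁅θ m x, θ n y⁆)

end Labute


end Literature.Algebra.Lie
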